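import Literature.RepresentationTheory.BorelWallach2000.UpqMaximalCompactBlocks   -- ★ `upqMaximalCompactEquiv`, `coe_kV`, `upq_coe_eq_fromBlocks_of_mem_kInLie`
import Literature.RepresentationTheory.BorelWallach2000.UpqCasimirTensor          -- ★ `upq_coe_eq_fromBlocks_of_mem_kInLie`, `torusGen`
import Mathlib.Analysis.Matrix.Spectrum
import Mathlib.Analysis.Matrix.Normed
import Mathlib.Analysis.Normed.Algebra.Spectrum
import HarnessLib

/-!
# Every `Y ∈ 𝔨 = 𝔲(α) ⊕ 𝔲(β)` is `Ad(k)` of a torus generator, `k ∈ K = U(α) × U(β)`, with rates bounded by `‖Y‖`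

Topic `NumberTheory/Automorphic`; namespace `Literature.NumberTheory.Automorphic`; THEOREMS ONLY (no `def`, no named fact, no instance declaration, no notation,
no `sorry`).  Cell `hodgecm-mathlib`, F0∕P3, T1a arch line, ROAD-GLOB (A6 #92 at `U(2,1)`), brick «FB», piece **T4b-i** (matrix side of the K-BOUND,
A-p06 (g24) plan 2026-08-31): the torus bound (★ T1∕T2∕T3) controls `ρ𝔤(t)` for torus generators `t = torusGen a b` only; an arbitrary `Y ∈ 𝔨` is
reached by conjugation — `Y = Ad(k) (torusGen a b)` with `k = kV (U₁, U₂)`, `U₁, U₂` the unitaries diagonalising the skew-Hermitian blocks of `Y`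
(Mathlib's spectral theorem for Hermitian matrices, applied to `i Y₁₁`, `i Y₂₂`), and `|a_j|, |b_l| ≤ ‖Y‖` for the `L^∞`-operator norm of ★ `GKModules` (H3)
(eigenvalues lie in the spectrum, `‖λ‖ ≤ ‖A‖`, and a diagonal block has norm `≤` the matrix).
THE LEAN TEXT: `linfty_opNorm_toBlocks₁₁_le`, `linfty_opNorm_toBlocks₂₂_le` (block norms) · `isHermitian_I_smul_of_conjTranspose_eq_neg` ·
`eq_conj_diagonal_of_skewHermitian` (`Y₁ = U diag(−i a) U⋆`, `|a_j| ≤ ‖Y₁‖`) · **`exists_Ad_torusGen_eq_of_mem_kInLie`**.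
[Knapp2002, IV §4 Thm. 4.34 (maximal tori are all conjugate)]; [BorelWallach2000, II §1.1 (5)].
HONEST LABEL: closes no registered stub by itself.  HC_CM is proved only modulo the 2 remaining named inputs (hLiu418, h413) until rung 0 closes.

## References
* A. W. Knapp, *Lie Groups Beyond an Introduction*, 2nd ed. (2002), IV §4 Thm. 4.34 [Knapp2002].
* A. Borel, N. Wallach, *Continuous cohomology, discrete subgroups, and representations of reductive groups*, 2nd ed. (2000), II §1.1 (5) [BorelWallach2000].
-/

set_option autoImplicit false

noncomputable section

namespace Literature.NumberTheory.Automorphic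

open scoped Matrix ComplexConjugate Matrix.Norms.Operator
open Literature.RepresentationTheory.KonnoKonno2007 Literature.RepresentationTheory.KonnoKonno2007.RealDualPair
open Literature.RepresentationTheory.KonnoKonno2007.RealDualPair.UForm (kV coe_kV)
open Literature.RepresentationTheory.BorelWallach2000

variable {α β : Type} [Fintype α] [DecidableEq α] [Fintype β] [DecidableEq β]

/-! ## §1 Norms of diagonal blocks (`L^∞`-operator norm) -/

/-- A diagonal block has `L^∞`-operator norm at most that of the matrix: `‖M₁₁‖ ≤ ‖M‖`. [folklore] [cite: Knapp2002, IV §4] -/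
theorem linfty_opNorm_toBlocks₁₁_le (M : Matrix (α ⊕ β) (α ⊕ β) ℂ) : ‖M.toBlocks₁₁‖ ≤ ‖M‖ := by
  have h : ‖M.toBlocks₁₁‖₊ ≤ ‖M‖₊ := by
    rw [Matrix.linfty_opNNNorm_def, Matrix.linfty_opNNNorm_def]
    refine Finset.sup_le fun i _ => ?_
    refine le_trans ?_ (Finset.le_sup (f := fun i : α ⊕ β => ∑ j : α ⊕ β, ‖M i j‖₊) (Finset.mem_univ (Sum.inl i)))
    simp only [Matrix.toBlocks₁₁, Matrix.of_apply, Fintype.sum_sum_type]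
    exact le_self_add
  exact_mod_cast h

/-- `‖M₂₂‖ ≤ ‖M‖`. [folklore] [cite: Knapp2002, IV §4] -/
theorem linfty_opNorm_toBlocks₂₂_le (M : Matrix (α ⊕ β) (α ⊕ β) ℂ) : ‖M.toBlocks₂₂‖ ≤ ‖M‖ := by
  have h : ‖M.toBlocks₂₂‖₊ ≤ ‖M‖₊ := by
    rw [Matrix.linfty_opNNNorm_def, Matrix.linfty_opNNNorm_def]
    refine Finset.sup_le fun i _ => ?_
    refine le_trans ?_ (Finset.le_sup (f := fun i : α ⊕ β => ∑ j : α ⊕ β, ‖M i j‖₊) (Finset.mem_univ (Sum.inr i)))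
    simp only [Matrix.toBlocks₂₂, Matrix.of_apply, Fintype.sum_sum_type]
    exact le_add_self
  exact_mod_cast h

/-! ## §2 A skew-Hermitian matrix is a unitary conjugate of `diag(−i a)` with `|a_j| ≤ ‖·‖` -/

section Skew

variable {n : Type} [Fintype n] [DecidableEq n]

omit [Fintype n] [DecidableEq n] in
/-- `i Y` is Hermitian when `Yᴴ = −Y`. [folklore] [cite: Knapp2002, IV §4] -/
theorem isHermitian_I_smul_of_conjTranspose_eq_neg {Y : Matrix n n ℂ} (hY : Matrix.conjTranspose Y = -Y) : (Complex.I • Y).IsHermitian := by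
  change Matrix.conjTranspose (Complex.I • Y) = Complex.I • Y
  rw [Matrix.conjTranspose_smul, hY, Complex.star_def, Complex.conj_I, smul_neg, neg_smul, neg_neg]

/-- **Unitary diagonalisation of a skew-Hermitian matrix with bounded rates**: `Yᴴ = −Y` ⇒ `Y = U · diag(−i a) · U⋆` for a unitary `U` and real `a` with
`|a_j| ≤ ‖Y‖` (`L^∞`-operator norm). [cite: Knapp2002, IV §4 Thm. 4.34] -/
theorem eq_conj_diagonal_of_skewHermitian [Nonempty n] {Y : Matrix n n ℂ} (hY : Matrix.conjTranspose Y = -Y) :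
    ∃ (U : Matrix.unitaryGroup n ℂ) (a : n → ℝ),
      Y = (U : Matrix n n ℂ) * Matrix.diagonal (fun j => -((a j : ℂ) * Complex.I)) * star (U : Matrix n n ℂ) ∧ ∀ j, |a j| ≤ ‖Y‖ := by
  have hH := isHermitian_I_smul_of_conjTranspose_eq_neg hY
  refine ⟨hH.eigenvectorUnitary, hH.eigenvalues, ?_, fun j => ?_⟩
  · -- `i Y = U D U⋆` with `D = diag(a)`, so `Y = U (−i D) U⋆`
    have h1 := hH.spectral_theorem
    rw [Unitary.conjStarAlgAut_apply] at h1
    have h2 : Y = -Complex.I • (Complex.I • Y) := by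
      rw [smul_smul, neg_mul, Complex.I_mul_I, neg_neg, one_smul]
    have h3 := congrArg (fun Z : Matrix n n ℂ => -Complex.I • Z) h1
    have hD : -Complex.I • Matrix.diagonal (RCLike.ofReal ∘ hH.eigenvalues : n → ℂ) =
        Matrix.diagonal (fun j => -((hH.eigenvalues j : ℂ) * Complex.I)) := by
      rw [← Matrix.diagonal_smul]
      congr 1
      ext j
      simp only [Pi.smul_apply, Function.comp_apply, smul_eq_mul]
      change -Complex.I * ((hH.eigenvalues j : ℝ) : ℂ) = _
      ring
    calc Y = -Complex.I • (Complex.I • Y) := h2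
      _ = -Complex.I • ((hH.eigenvectorUnitary : Matrix n n ℂ) * Matrix.diagonal (RCLike.ofReal ∘ hH.eigenvalues) *
            star (hH.eigenvectorUnitary : Matrix n n ℂ)) := h3
      _ = (hH.eigenvectorUnitary : Matrix n n ℂ) * (-Complex.I • Matrix.diagonal (RCLike.ofReal ∘ hH.eigenvalues)) *
            star (hH.eigenvectorUnitary : Matrix n n ℂ) := by rw [Matrix.mul_smul, Matrix.smul_mul]
      _ = _ := by rw [hD]
  · -- `a_j ∈ spectrum ℝ (i Y)` and `‖λ‖ ≤ ‖i Y‖ = ‖Y‖`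
    have hmem := hH.eigenvalues_mem_spectrum_real j
    have hle := spectrum.norm_le_norm_of_mem hmem
    rw [Real.norm_eq_abs] at hle
    refine hle.trans ?_
    rw [norm_smul, Complex.norm_I, one_mul]

end Skew

/-! ## §3 `𝔨 = Ad(K) · 𝔱` with bounded rates -/

/-- **T4b-i.**  Every `Y ∈ 𝔨` is `Ad(k) (torusGen a b)` for some `k = kV (U₁, U₂) ∈ K = U(α) × U(β)` and real rates with `|a_j|, |b_l| ≤ ‖Y‖`.
[cite: Knapp2002, IV §4 Thm. 4.34] [cite: BorelWallach2000, II §1.1 (5)] -/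
theorem exists_Ad_torusGen_eq_of_mem_kInLie [Nonempty α] [Nonempty β] (Y : (uFormGroup α β).lie) (hY : Y ∈ (uFormGroup α β).kInLie) :
    ∃ (U₁ : Matrix.unitaryGroup α ℂ) (U₂ : Matrix.unitaryGroup β ℂ) (a : α → ℝ) (b : β → ℝ),
      (uFormGroup α β).Ad (Subgroup.inclusion (uFormGroup α β).maximalCompact_le_carrier (upqMaximalCompactEquiv.symm (U₁, U₂)))
          ⟨torusGen a b, torusGen_mem_lie a b⟩ = Y ∧
        (∀ j, |a j| ≤ ‖(Y : Matrix (α ⊕ β) (α ⊕ β) ℂ)‖) ∧ (∀ l, |b l| ≤ ‖(Y : Matrix (α ⊕ β) (α ⊕ β) ℂ)‖) := by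
  set M : Matrix (α ⊕ β) (α ⊕ β) ℂ := (Y : Matrix (α ⊕ β) (α ⊕ β) ℂ) with hM
  obtain ⟨h11, h22, -⟩ := upq_lie_blocks Y
  obtain ⟨U₁, a, hY₁, ha⟩ := eq_conj_diagonal_of_skewHermitian h11
  obtain ⟨U₂, b, hY₂, hb⟩ := eq_conj_diagonal_of_skewHermitian h22
  refine ⟨U₁, U₂, a, b, ?_, fun j => (ha j).trans (linfty_opNorm_toBlocks₁₁_le M), fun l => (hb l).trans (linfty_opNorm_toBlocks₂₂_le M)⟩
  apply Subtype.ext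
  rw [RealMatrixGroup.Ad_apply_coe]
  -- the matrices of `k` and `k⁻¹`
  set k : (uFormGroup α β).maximalCompact := upqMaximalCompactEquiv.symm (U₁, U₂) with hk
  have hkmat : (((Subgroup.inclusion (uFormGroup α β).maximalCompact_le_carrier k : (uFormGroup α β).carrier) : GL (α ⊕ β) ℂ) :
      Matrix (α ⊕ β) (α ⊕ β) ℂ) = Matrix.fromBlocks (U₁ : Matrix α α ℂ) 0 0 (U₂ : Matrix β β ℂ) := by
    change (((k : (uFormGroup α β).maximalCompact) : GL (α ⊕ β) ℂ) : Matrix (α ⊕ β) (α ⊕ β) ℂ) = _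
    rw [hk, coe_upqMaximalCompactEquiv_symm_apply, coe_kV]
  have hkinv : ((((Subgroup.inclusion (uFormGroup α β).maximalCompact_le_carrier k : (uFormGroup α β).carrier) : GL (α ⊕ β) ℂ)⁻¹ : GL (α ⊕ β) ℂ) :
      Matrix (α ⊕ β) (α ⊕ β) ℂ) = Matrix.fromBlocks (star (U₁ : Matrix α α ℂ)) 0 0 (star (U₂ : Matrix β β ℂ)) := by
    have h1 : (((Subgroup.inclusion (uFormGroup α β).maximalCompact_le_carrier k : (uFormGroup α β).carrier) : GL (α ⊕ β) ℂ)⁻¹ : GL (α ⊕ β) ℂ) =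
        ((Subgroup.inclusion (uFormGroup α β).maximalCompact_le_carrier k⁻¹ : (uFormGroup α β).carrier) : GL (α ⊕ β) ℂ) := by
      rw [map_inv]; rfl
    rw [h1]
    change (((k⁻¹ : (uFormGroup α β).maximalCompact) : GL (α ⊕ β) ℂ) : Matrix (α ⊕ β) (α ⊕ β) ℂ) = _
    rw [hk, ← map_inv, Prod.inv_mk, coe_upqMaximalCompactEquiv_symm_apply, coe_kV]
    simp only [Matrix.UnitaryGroup.inv_val]
  rw [hkmat, hkinv]
  -- block computation
  have hYb : M = Matrix.fromBlocks M.toBlocks₁₁ 0 0 M.toBlocks₂₂ := upq_coe_eq_fromBlocks_of_mem_kInLie Y hY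
  change Matrix.fromBlocks (U₁ : Matrix α α ℂ) 0 0 (U₂ : Matrix β β ℂ) * torusGen a b *
      Matrix.fromBlocks (star (U₁ : Matrix α α ℂ)) 0 0 (star (U₂ : Matrix β β ℂ)) = M
  rw [hYb, torusGen, ← Matrix.fromBlocks_diagonal, Matrix.fromBlocks_multiply, Matrix.fromBlocks_multiply]
  simp only [Matrix.mul_zero, Matrix.zero_mul, add_zero, zero_add]
  rw [← hY₁, ← hY₂]

end Literature.NumberTheory.Automorphic

end
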